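import Summits.CriticalPhenomena.PercolationContinuityZ3.Theorems.Transplant.FKConnectivityAllQArborealDefs
import Summits.CriticalPhenomena.PercolationContinuityZ3.Theorems.Transplant.FKConnectivityAllQClusterDom
import HarnessLib

/-!
# The arboreal gas — AUXILIARY DEFINITIONS: the deficiency `|ω| + k(ω) − |V|`, the normalising product and the polynomials of the
# arboreal curve, expectations `E^F_w`, and the two FOREST CLUSTER NODES (forest-MM `ArborealClusterDomAdjOn`, forest-CA
# `ArborealClusterAssocOn`; conjecture-shaped, NOT asserted)

Definitions file (`--supports stmt-CriticalPhenomena-4575`), FK sub-lane `prim-bschramm-fk-1` (gen 9) of the post-continuity programme;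
builds on p205010 (kernel theorem, internal audit signed; external expert review pending).  Pure definitions; the theorems live in
`…ArborealLimit.lean` (`φ_{p(q),q} ⇒` arboreal gas as `q ↓ 0`; `HubFKPos → ArborealHubPos`; ALR Conj. 7.1 on 2-tree supports) and
`…ArborealCluster.lean` (forest-MM ⇒ forest-CA ⇒ `ArborealHubPos`, Harris' induction on the pairs at the tree).

* `defi ω = |ω| + k(ω) − |V|` (a natural number: `|V| ≤ |ω| + k(ω)`, with equality exactly on forests — Grimmett §1.5).
* `agNorm w q = ∏_e (1 − w_e + w_e q)`, `agPoly w E q = Σ_{ω ∈ E} (∏_e w_e^{ω(e)}(1−w_e)^{1−ω(e)})·q^{defi ω}` — on the arboreal curve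
  `φ_{p(q),q}(E) = agPoly w E q / agPoly w Ω q`.
* `agE w h = Σ_ω agMass_w(ω)·h(ω)`.
* `ArborealClusterDomAdjOn V` (forest-MM): `μ(T_x ∈ 𝒰)·μ(xz ∈ F) ≤ μ(Ω)·μ(T_x ∈ 𝒰, xz ∈ F)` for the arboreal gas `μ = agMeasure w`, every
  `w`, `x`, `z`, up-set `𝒰` — the `q ↓ 0` shadow of fk-1 g7's MM (census fk-1 g8: forest-MM 0 violations / 5,400 random weighted
  instances, `n ≤ 8`, all up-sets); `ArborealClusterAssocOn V` (forest-CA): `μ(T_x ∈ 𝒰)μ(T_x ∈ 𝒱) ≤ μ(Ω)μ(T_x ∈ 𝒰 ∩ 𝒱)`; `…Pos` = all `Fin n`.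
[cite: Grimmett2006, §1.5 eq. (1.22), Thm. (1.23) (pp. 13–14); §3.9 (pp. 63–65)] [cite: AyyerLinussonRavichandran2025, §7 eq. (15), Conj. 7.1 (p. 22)]
-/

noncomputable section

namespace Summit.CriticalPhenomena.PercolationContinuityZ3.Theorems

namespace FK

open MeasureTheory Set Literature.Probability.LatticeModels Literature.Probability.Percolation
open scoped Classical
open BHK2006 DecisionTree

variable {V : Type*} [Fintype V] (w : Sym2 V → unitInterval)

/-- The **deficiency** `|ω| + k(ω) − |V|` of a configuration (a natural number by the previous theorem). [cite: Grimmett2006, §1.5 (p. 13)] -/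
def defi (ω : BondConfig V) : ℕ := ω.ncard + clusterCount ω ∅ - Fintype.card V

/-- The normalising product `c(q) = ∏_e (1 − w_e + w_e q)` of the arboreal curve (positive for `q > 0`). [cite: Grimmett2006, §1.5 (pp. 13–14)] -/
def agNorm (q : ℝ) : ℝ := ∏ e : Sym2 V, (1 - (w e : ℝ) + (w e : ℝ) * q)

/-- The polynomial `P_E(q) = Σ_ω 1_E(ω)·(∏_e w_e^{ω(e)}(1−w_e)^{1−ω(e)})·q^{defi ω}`. [cite: Grimmett2006, §1.5 (pp. 13–14)] -/
def agPoly (E : Set (BondConfig V)) (q : ℝ) : ℝ := ∑ ω : BondConfig V, weight (fun e => (w e : ℝ)) ω * q ^ defi ω * ind E ω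

/-- `E^F_w[h] = Σ_ω agMass_w(ω)·h(ω)`. [cite: Grimmett2006, §1.5 eq. (1.22) (p. 13)] -/
def agE (h : BondConfig V → ℝ) : ℝ := ∑ ω : BondConfig V, agMass w ω * h ω

/-- **forest-MM on the vertex type `V`**: for the arboreal gas with parameters `w`, a pair `f = xz` at `x` and an up-set `𝒰` of vertex sets,
the tree of `x` and the presence of `f` are positively correlated: `μ(T_x ∈ 𝒰)·μ(f ∈ F) ≤ μ(Ω)·μ(T_x ∈ 𝒰, f ∈ F)` (equivalently, when
both conditional laws exist, `law(T_x | f ∈ F) ⪰ law(T_x | f ∉ F)`).  The `q ↓ 0` shadow of fk-1 g7's MM; conjectural (fk-1 g8 census: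
0 violations in 5,400 random weighted instances on `≤ 8` vertices, all up-sets). [cite: AyyerLinussonRavichandran2025, §7 Conj. 7.1 (p. 22)]
[cite: Grimmett2006, §1.5 eq. (1.22) (p. 13); §3.9 (pp. 63–65)] -/
def ArborealClusterDomAdjOn (V : Type*) [Fintype V] : Prop :=
  ∀ (w : Sym2 V → unitInterval) (x z : V) (𝒰 : Set (Set V)), IsUpperSet 𝒰 →
    (agMeasure w).real (clusterIn x 𝒰) * (agMeasure w).real {ω | s(x, z) ∈ ω} ≤
      (agMeasure w).real univ * (agMeasure w).real (clusterIn x 𝒰 ∩ {ω | s(x, z) ∈ ω})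

/-- **forest-CA on the vertex type `V`**: the law of the tree `T_x` of a vertex under the arboreal gas is positively associated:
`μ(T_x ∈ 𝒰)·μ(T_x ∈ 𝒱) ≤ μ(Ω)·μ(T_x ∈ 𝒰 ∩ 𝒱)` for up-sets `𝒰, 𝒱` (homogeneous form).  Contains ALR's Conjecture 7.1 (`𝒰 = {S ∋ o}`,
`𝒱 = {S ∋ b}`). [cite: AyyerLinussonRavichandran2025, §7 Conj. 7.1 (p. 22)] [cite: Grimmett2006, §3.9 (pp. 63–65)] -/
def ArborealClusterAssocOn (V : Type*) [Fintype V] : Prop :=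
  ∀ (w : Sym2 V → unitInterval) (x : V) (𝒰 𝒱 : Set (Set V)), IsUpperSet 𝒰 → IsUpperSet 𝒱 →
    (agMeasure w).real (clusterIn x 𝒰) * (agMeasure w).real (clusterIn x 𝒱) ≤
      (agMeasure w).real univ * (agMeasure w).real (clusterIn x 𝒰 ∩ clusterIn x 𝒱)

/-- **forest-MM for every finite weighted graph.**  CONJECTURE-SHAPED STATEMENT, NOT asserted. [cite: AyyerLinussonRavichandran2025, §7 Conj. 7.1 (p. 22)] -/
@[conjecture] def ArborealClusterDomAdjPos : Prop := ∀ n : ℕ, ArborealClusterDomAdjOn (Fin n)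

/-- **forest-CA for every finite weighted graph.**  CONJECTURE-SHAPED STATEMENT, NOT asserted. [cite: AyyerLinussonRavichandran2025, §7 Conj. 7.1 (p. 22)] -/
@[conjecture] def ArborealClusterAssocPos : Prop := ∀ n : ℕ, ArborealClusterAssocOn (Fin n)

end FK

end Summit.CriticalPhenomena.PercolationContinuityZ3.Theorems

end
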